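import Summits.QuantumFields.YangMills.Theorems.AllWindowsColdBoxBoxHighLineLaplaceSandwich

/-!
# Laplace SANDWICH for the orbit average `N_h` — part (4k-D): region-split glue with CONSTANT-FACTOR slots and a FAR-REGION term
# (the exact shape `STUB-PLAN-S5U5-STEP1c.md` §2 asks for; T-S5.4 of LINE-19 S5 ⟨stmt-QuantumFields-24004⟩/⟨24335⟩, LINE-20 U5 ⟨24336⟩;
# seat ym-line-fcl-p3 g25)

Over 4k-B (`…LaplaceSandwich`: `laplace_sandwich_upper/lower`, masses `Z(Q) = √(2π)^{|ι|}/√det Q`, ½-convention).  STEP1c §2 bounds the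
symmetrised integrand `Ψ` on three regions: the sup-box `B = {∀ i, |vᵢ| < ρ}` (bulk, Gaussian `e^{−½vᵀ(P∓τ1)v}` up to the constant odd/Haar
factors `K`), the intermediate shell (Gaussian `K₂·e^{−½vᵀP'v}`, `P' = (1−ε′)P`) and the far region (a separately integrable majorant `g₃`, from 4ℓ
coercivity × the Haar probability density).  This file supplies exactly those slots:
* §1 `integral_le_of_box_split` / `integral_ge_of_box_split` — the measure-theoretic split at the box (any nonnegative integrable majorants/minorant);
* §2 ★★ `laplace_sandwich_upper_far` — `Ψ ≤ K₁e^{−½vᵀ(P−τ1)v}` on `B`, `Ψ ≤ K₂e^{−½vᵀP'v} + g₃` off `B` ⇒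
  `∫Ψ ≤ K₁·e^{(τ/2)tr(P−τ1)⁻¹}·Z(P) + K₂·2(Σᵢe^{−ρ²/(2(P'⁻¹)ᵢᵢ)})·Z(P') + ∫g₃`;
  ★★ `laplace_sandwich_lower_const` — `Ψ ≥ K·e^{−½vᵀ(P+τ1)v}` on `B` ⇒ `K·(e^{−(τ/2)trP⁻¹} − 2Σᵢe^{−ρ²/(2((P+τ1)⁻¹)ᵢᵢ)})·Z(P) ≤ ∫Ψ`.
Symmetrisation `∫Ψ(−v)dv = ∫Ψ(v)dv` on `ι → ℝ` is Mathlib's `integral_neg_eq_self Ψ volume` (Lebesgue on `ι → ℝ` is neg-invariant), so the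
recipe's `Ψ = ½[f(v) + f(−v)]` has the same integral as `f`.

HONEST LABEL: bookkeeping for step (1b) of S5/U5; T-S5.4, S5, U5 and the three items are OPEN; the Yang–Mills mass gap is NOT proved by this
file; no summit is proved by a line.
-/

set_option autoImplicit false

noncomputable section

open MeasureTheory Matrix Real

namespace Summit.QuantumFields.YangMills.Theorems.AllWindowsColdBoxBoxHighLine.LaplaceSandwich

open Literature.MathematicalPhysics.QuantumFieldTheory
open Literature.MathematicalPhysics.QuantumFieldTheory.Balaban1983to89.Beta

variable {ι : Type*} [Fintype ι] [DecidableEq ι]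

/-! ## §1 Splitting an integral at the sup-box -/

omit [DecidableEq ι] in
/-- **Upper split at the box**: if `0 ≤ Ψ ≤ g₁` on `{∀ i, |vᵢ| < ρ}` and `Ψ ≤ g₂` off it, with `g₁, g₂ ≥ 0` integrable, then
`∫Ψ ≤ ∫g₁ + ∫_{∃ i, ρ ≤ |vᵢ|} g₂`.  No measurability of `Ψ` is needed. [folklore] -/
theorem integral_le_of_box_split {ρ : ℝ} {Ψ g₁ g₂ : (ι → ℝ) → ℝ} (hΨ0 : ∀ v, 0 ≤ Ψ v) (hg₁ : ∀ v, 0 ≤ g₁ v) (hg₂ : ∀ v, 0 ≤ g₂ v)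
    (hg₁i : Integrable g₁) (hg₂i : Integrable g₂)
    (hbulk : ∀ v : ι → ℝ, (∀ i, |v i| < ρ) → Ψ v ≤ g₁ v) (hshell : ∀ v : ι → ℝ, (∃ i, ρ ≤ |v i|) → Ψ v ≤ g₂ v) :
    ∫ v, Ψ v ≤ (∫ v, g₁ v) + ∫ v in {v : ι → ℝ | ∃ i, ρ ≤ |v i|}, g₂ v := by
  set S : Set (ι → ℝ) := {v | ∃ i, ρ ≤ |v i|} with hS
  have hSm : MeasurableSet S := measurableSet_exists_coord_tail ρ
  have hdom : ∀ v, Ψ v ≤ g₁ v + S.indicator g₂ v := by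
    intro v
    by_cases hv : ∀ i, |v i| < ρ
    · have h1 := hbulk v hv
      have h2 : 0 ≤ S.indicator g₂ v := Set.indicator_nonneg (fun w _ => hg₂ w) v
      linarith
    · have hv' : v ∈ S := (not_forall_abs_lt_iff v ρ).1 hv
      rw [Set.indicator_of_mem hv']
      linarith [hshell v hv', hg₁ v]
  calc ∫ v, Ψ v ≤ ∫ v, (g₁ v + S.indicator g₂ v) :=
        integral_mono_of_nonneg (ae_of_all _ hΨ0) (hg₁i.add (hg₂i.indicator hSm)) (ae_of_all _ hdom)
    _ = (∫ v, g₁ v) + ∫ v in S, g₂ v := by rw [integral_add hg₁i (hg₂i.indicator hSm), integral_indicator hSm]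

omit [DecidableEq ι] in
/-- **Lower split at the box**: if `Ψ ≥ 0` is integrable and `Ψ ≥ g` on `{∀ i, |vᵢ| < ρ}` with `g` integrable, then
`∫g − ∫_{∃ i, ρ ≤ |vᵢ|} g ≤ ∫Ψ`. [folklore] -/
theorem integral_ge_of_box_split {ρ : ℝ} {Ψ g : (ι → ℝ) → ℝ} (hΨ0 : ∀ v, 0 ≤ Ψ v) (hΨi : Integrable Ψ) (hgi : Integrable g)
    (hbulk : ∀ v : ι → ℝ, (∀ i, |v i| < ρ) → g v ≤ Ψ v) :
    (∫ v, g v) - ∫ v in {v : ι → ℝ | ∃ i, ρ ≤ |v i|}, g v ≤ ∫ v, Ψ v := by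
  set S : Set (ι → ℝ) := {v | ∃ i, ρ ≤ |v i|} with hS
  have hSm : MeasurableSet S := measurableSet_exists_coord_tail ρ
  have hdom : ∀ v, g v - S.indicator g v ≤ Ψ v := by
    intro v
    by_cases hv : ∀ i, |v i| < ρ
    · have hv' : v ∉ S := fun h => (not_forall_abs_lt_iff v ρ).2 h hv
      rw [Set.indicator_of_notMem hv', sub_zero]
      exact hbulk v hv
    · have hv' : v ∈ S := (not_forall_abs_lt_iff v ρ).1 hv
      rw [Set.indicator_of_mem hv', sub_self]
      exact hΨ0 v
  calc (∫ v, g v) - ∫ v in S, g v = ∫ v, (g v - S.indicator g v) := by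
        rw [integral_sub hgi (hgi.indicator hSm), integral_indicator hSm]
    _ ≤ ∫ v, Ψ v := integral_mono (hgi.sub (hgi.indicator hSm)) hΨi hdom

/-! ## §2 The sandwich with constant factors and a far-region term -/

/-- ★★ **LAPLACE SANDWICH, UPPER, with constant slots and a far-region majorant** (STEP1c §2 shape): let `P − τ1` (`τ ≥ 0`) and `P'` be positive
definite, `ρ ≥ 0`, `K₁, K₂ ≥ 0`, `g₃ ≥ 0` integrable, `0 ≤ Ψ` with `Ψ ≤ K₁·e^{−½vᵀ(P−τ1)v}` on the box `{∀ i, |vᵢ| < ρ}` and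
`Ψ ≤ K₂·e^{−½vᵀP'v} + g₃` off it.  Then
`∫Ψ ≤ K₁·e^{(τ/2)tr(P−τ1)⁻¹}·Z(P) + K₂·2(Σᵢ e^{−ρ²/(2(P'⁻¹)ᵢᵢ)})·Z(P') + ∫g₃`. [folklore] -/
theorem laplace_sandwich_upper_far {P P' : Matrix ι ι ℝ} (hP' : P'.PosDef) {τ ρ K₁ K₂ : ℝ} (hτ : 0 ≤ τ)
    (hPτ : (P - τ • (1 : Matrix ι ι ℝ)).PosDef) (hρ : 0 ≤ ρ) (hK₁ : 0 ≤ K₁) (hK₂ : 0 ≤ K₂)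
    {Ψ g₃ : (ι → ℝ) → ℝ} (hΨ0 : ∀ v, 0 ≤ Ψ v) (hg₃ : ∀ v, 0 ≤ g₃ v) (hg₃i : Integrable g₃)
    (hbulk : ∀ v : ι → ℝ, (∀ i, |v i| < ρ) → Ψ v ≤ K₁ * Real.exp (-(1/2 : ℝ) * (v ⬝ᵥ (P - τ • (1 : Matrix ι ι ℝ)) *ᵥ v)))
    (hshell : ∀ v : ι → ℝ, (∃ i, ρ ≤ |v i|) → Ψ v ≤ K₂ * Real.exp (-(1/2 : ℝ) * (v ⬝ᵥ P' *ᵥ v)) + g₃ v) :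
    ∫ v, Ψ v ≤
      K₁ * (Real.exp (τ / 2 * (P - τ • (1 : Matrix ι ι ℝ))⁻¹.trace) * (Real.sqrt (2 * Real.pi) ^ Fintype.card ι / Real.sqrt P.det)) +
        K₂ * (2 * (∑ i, Real.exp (-(ρ ^ 2 / (2 * P'⁻¹ i i)))) * (Real.sqrt (2 * Real.pi) ^ Fintype.card ι / Real.sqrt P'.det)) +
          ∫ v, g₃ v := by
  set fτ : (ι → ℝ) → ℝ := fun v => Real.exp (-(1/2 : ℝ) * (v ⬝ᵥ (P - τ • (1 : Matrix ι ι ℝ)) *ᵥ v)) with hfτ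
  set f' : (ι → ℝ) → ℝ := fun v => Real.exp (-(1/2 : ℝ) * (v ⬝ᵥ P' *ᵥ v)) with hf'
  have hfτi : Integrable fτ := GaussianIntegral.integrable_exp_neg_half_quadForm _ hPτ
  have hf'i : Integrable f' := GaussianIntegral.integrable_exp_neg_half_quadForm _ hP'
  have h := integral_le_of_box_split (g₁ := fun v => K₁ * fτ v) (g₂ := fun v => K₂ * f' v + g₃ v) hΨ0
    (fun v => mul_nonneg hK₁ (Real.exp_pos _).le) (fun v => add_nonneg (mul_nonneg hK₂ (Real.exp_pos _).le) (hg₃ v))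
    (hfτi.const_mul K₁) ((hf'i.const_mul K₂).add hg₃i) hbulk hshell
  have hSm : MeasurableSet {v : ι → ℝ | ∃ i, ρ ≤ |v i|} := measurableSet_exists_coord_tail ρ
  have h1 : ∫ v, K₁ * fτ v ≤ K₁ * (Real.exp (τ / 2 * (P - τ • (1 : Matrix ι ι ℝ))⁻¹.trace) *
      (Real.sqrt (2 * Real.pi) ^ Fintype.card ι / Real.sqrt P.det)) := by
    rw [integral_const_mul, hfτ, GaussianIntegral.integral_exp_neg_half_quadForm _ hPτ]
    exact mul_le_mul_of_nonneg_left (mass_sub_smul_one_le hPτ hτ) hK₁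
  have h2 : ∫ v in {v : ι → ℝ | ∃ i, ρ ≤ |v i|}, (K₂ * f' v + g₃ v) ≤
      K₂ * (2 * (∑ i, Real.exp (-(ρ ^ 2 / (2 * P'⁻¹ i i)))) * (Real.sqrt (2 * Real.pi) ^ Fintype.card ι / Real.sqrt P'.det)) +
        ∫ v, g₃ v := by
    rw [integral_add (hf'i.const_mul K₂).integrableOn hg₃i.integrableOn, integral_const_mul]
    exact add_le_add (mul_le_mul_of_nonneg_left (setIntegral_exists_coord_tail_le hP' hρ) hK₂)
      (setIntegral_le_integral hg₃i (ae_of_all _ hg₃))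
  linarith

/-- ★★ **LAPLACE SANDWICH, LOWER, with a constant slot**: `P` positive definite, `τ, ρ, K ≥ 0`, `0 ≤ Ψ` integrable with
`Ψ ≥ K·e^{−½vᵀ(P+τ1)v}` on the box `{∀ i, |vᵢ| < ρ}`.  Then `K·(e^{−(τ/2)tr P⁻¹} − 2Σᵢ e^{−ρ²/(2((P+τ1)⁻¹)ᵢᵢ)})·Z(P) ≤ ∫Ψ`. [folklore] -/
theorem laplace_sandwich_lower_const {P : Matrix ι ι ℝ} (hP : P.PosDef) {τ ρ K : ℝ} (hτ : 0 ≤ τ) (hρ : 0 ≤ ρ) (hK : 0 ≤ K)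
    {Ψ : (ι → ℝ) → ℝ} (hΨ0 : ∀ v, 0 ≤ Ψ v) (hΨi : Integrable Ψ)
    (hbulk : ∀ v : ι → ℝ, (∀ i, |v i| < ρ) → K * Real.exp (-(1/2 : ℝ) * (v ⬝ᵥ (P + τ • (1 : Matrix ι ι ℝ)) *ᵥ v)) ≤ Ψ v) :
    K * ((Real.exp (-(τ / 2 * P⁻¹.trace)) - 2 * ∑ i, Real.exp (-(ρ ^ 2 / (2 * (P + τ • (1 : Matrix ι ι ℝ))⁻¹ i i)))) *
        (Real.sqrt (2 * Real.pi) ^ Fintype.card ι / Real.sqrt P.det)) ≤ ∫ v, Ψ v := by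
  set Pτ : Matrix ι ι ℝ := P + τ • (1 : Matrix ι ι ℝ) with hPτ_def
  have hPτ : Pτ.PosDef := posDef_add_smul_one hP hτ
  set fτ : (ι → ℝ) → ℝ := fun v => Real.exp (-(1/2 : ℝ) * (v ⬝ᵥ Pτ *ᵥ v)) with hfτ
  have hfτi : Integrable fτ := GaussianIntegral.integrable_exp_neg_half_quadForm _ hPτ
  have h := integral_ge_of_box_split (g := fun v => K * fτ v) hΨ0 hΨi (hfτi.const_mul K) hbulk
  have hZτ : ∫ v, fτ v = Real.sqrt (2 * Real.pi) ^ Fintype.card ι / Real.sqrt Pτ.det :=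
    GaussianIntegral.integral_exp_neg_half_quadForm _ hPτ
  have hlow : Real.exp (-(τ / 2 * P⁻¹.trace)) * (Real.sqrt (2 * Real.pi) ^ Fintype.card ι / Real.sqrt P.det) ≤ ∫ v, fτ v :=
    integral_weight_add_smul_one_ge hP hτ
  have hZle : Real.sqrt (2 * Real.pi) ^ Fintype.card ι / Real.sqrt Pτ.det ≤
      Real.sqrt (2 * Real.pi) ^ Fintype.card ι / Real.sqrt P.det := by
    rw [← hZτ]; exact integral_weight_add_smul_one_le hP hτ
  have htail : ∫ v in {v : ι → ℝ | ∃ i, ρ ≤ |v i|}, fτ v ≤ 2 * (∑ i, Real.exp (-(ρ ^ 2 / (2 * Pτ⁻¹ i i)))) *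
      (Real.sqrt (2 * Real.pi) ^ Fintype.card ι / Real.sqrt P.det) :=
    (setIntegral_exists_coord_tail_le hPτ hρ).trans (mul_le_mul_of_nonneg_left hZle (by positivity))
  have hsplit : (∫ v, K * fτ v) - ∫ v in {v : ι → ℝ | ∃ i, ρ ≤ |v i|}, K * fτ v =
      K * ((∫ v, fτ v) - ∫ v in {v : ι → ℝ | ∃ i, ρ ≤ |v i|}, fτ v) := by
    rw [integral_const_mul, integral_const_mul, mul_sub]
  rw [hsplit] at h
  calc K * ((Real.exp (-(τ / 2 * P⁻¹.trace)) - 2 * ∑ i, Real.exp (-(ρ ^ 2 / (2 * Pτ⁻¹ i i)))) *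
        (Real.sqrt (2 * Real.pi) ^ Fintype.card ι / Real.sqrt P.det))
      ≤ K * ((∫ v, fτ v) - ∫ v in {v : ι → ℝ | ∃ i, ρ ≤ |v i|}, fτ v) := by
        refine mul_le_mul_of_nonneg_left ?_ hK
        have : (Real.exp (-(τ / 2 * P⁻¹.trace)) - 2 * ∑ i, Real.exp (-(ρ ^ 2 / (2 * Pτ⁻¹ i i)))) *
            (Real.sqrt (2 * Real.pi) ^ Fintype.card ι / Real.sqrt P.det) =
            Real.exp (-(τ / 2 * P⁻¹.trace)) * (Real.sqrt (2 * Real.pi) ^ Fintype.card ι / Real.sqrt P.det) -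
              2 * (∑ i, Real.exp (-(ρ ^ 2 / (2 * Pτ⁻¹ i i)))) * (Real.sqrt (2 * Real.pi) ^ Fintype.card ι / Real.sqrt P.det) := by
          ring
        rw [this]
        exact sub_le_sub hlow htail
    _ ≤ ∫ v, Ψ v := h

end Summit.QuantumFields.YangMills.Theorems.AllWindowsColdBoxBoxHighLine.LaplaceSandwich

end
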